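import Literature.Analysis.FluidPDE.StatisticalSolutionProofs

/-!
# Stub `stub_relaxedLoudOfFloor` (T2) of the line `Sketch`
# (crux stmt-AnomalousDissipation-14086, `TaylorCertificates.FloorCertificateEnsembleCeiling`)

WEAK DUALITY FOR THE DISSIPATION FLOOR AT ONE VISCOSITY (constant budget). If a constant budget
`ε` obeys the floor `ε ≤ ν‖∇u‖² + ⟨F(u), Φ₁'(u)⟩ + 2θ₁((u,f) − ν‖∇u‖²)` at every finite-enstrophy
state `u` of the Leray ball `|u|² ≤ 16‖f‖²/ν²`, with `θ₁ ≤ 0`, and `μ` is a probability measure on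
the energy space `H` carried by that ball, of finite mean enstrophy, annihilating the Liouville
functional of `Φ₁`, with integrable work `(u,f)` and the global energy inequality
`ε(μ) := Torus.ensembleDissipation ν μ ≤ ∫ (u,f) dμ`, then `ε ≤ ε(μ)`.

Proof. The budget floor holds `μ`-a.e. (finite enstrophy a.e. by `ae_lt_top`, ball a.e.);
integrate it (`integral_mono_ae`) and split the right-hand side: the Liouville identity kills the
generator term, `integral_toReal` turns `∫ ‖∇u‖²` into the mean enstrophy, and
`2θ₁ (∫(u,f)dμ − ε(μ)) ≤ 0` by `θ₁ ≤ 0` and the energy inequality; finally `∫ ε dμ = ε` for the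
probability measure `μ`. The state-dependent-budget step is the landed
`TaylorCertificatesFloorCertificateEnsembleCeilingStubWeakDualityBudget.stub_weakDualityBudget`,
reproduced here as a private lemma so that this file elaborates from `Literature` alone.

References: Foias–Manley–Rosa–Temam 2001, Ch. IV Def. 1.3 and Ch. V §1 (stationary statistical
solutions, mean dissipation); Doering–Foias 2002, §2.
-/

set_option linter.dupNamespace false

noncomputable section

namespace Summit.AnomalousDissipation.AnomalousDissipation.Theorems.TaylorCertificatesFloorCertificateEnsembleCeiling

open MeasureTheory
open scoped ENNReal
open Literature.Analysis.FunctionSpaces Literature.Analysis.FluidPDE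

/-- Local notation: real vector fields on `T³`. -/
local notation "Vec3" => (UnitAddTorus (Fin 3)) → (EuclideanSpace ℝ (Fin 3))
/-- Local notation: `L²(T³; ℝ³)`. -/
local notation "L2" => (Lp (EuclideanSpace ℝ (Fin 3)) 2 (volume : Measure (UnitAddTorus (Fin 3))))
/-- Local notation: the energy space `H`. -/
local notation "H3" => (Torus.energySpace (Fin 3))

/-- Weak duality with a state-dependent budget `g` over the relaxed class: if
`g(u) ≤ ν‖∇u‖² + ⟨F(u),Φ₁'(u)⟩ + 2θ₁((u,f) − ν‖∇u‖²)` at every finite-enstrophy state of the Leray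
ball, `θ₁ ≤ 0`, and `μ` is a probability measure on `H` carried by the ball, of finite mean
enstrophy, annihilating the Liouville functional of `Φ₁`, with integrable work and the global
energy inequality, then `∫ g dμ ≤ ε(μ)` for `μ`-integrable `g`. (A private copy of the landed
`stub_weakDualityBudget`.) -/
private theorem weakDualityBudget_local (ν : ℝ) (f : Vec3) (Φ₁ : Torus.CylindricalTest (Fin 3))
    (θ₁ : ℝ) (g : H3 → ℝ) (μ : Measure H3) (hθ₁ : θ₁ ≤ 0)
    (hfloor : ∀ u : H3, Torus.eGradNormSq ((u : L2) : Vec3) ≠ ⊤ →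
      ‖u‖ ^ 2 ≤ 16 * (∫ x, ‖f x‖ ^ 2) / ν ^ 2 →
        g u ≤ ν * (Torus.eGradNormSq ((u : L2) : Vec3)).toReal + Torus.nsGeneratorPairing ν f u (Φ₁.grad u) +
          2 * θ₁ * (Torus.pairing (u : L2) f - ν * (Torus.eGradNormSq ((u : L2) : Vec3)).toReal))
    (hball : ∀ᵐ u ∂μ, ‖u‖ ^ 2 ≤ 16 * (∫ x, ‖f x‖ ^ 2) / ν ^ 2)
    (hZ : Torus.ensembleEnstrophy μ < ⊤)
    (hC : Integrable (fun u : H3 => Torus.nsGeneratorPairing ν f u (Φ₁.grad u)) μ)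
    (hC0 : ∫ u, Torus.nsGeneratorPairing ν f u (Φ₁.grad u) ∂μ = 0)
    (hB : Integrable (fun u : H3 => Torus.pairing (u : L2) f) μ)
    (hE : Torus.ensembleDissipation ν μ ≤ ∫ u, Torus.pairing (u : L2) f ∂μ)
    (hg : Integrable g μ) :
    ∫ u, g u ∂μ ≤ Torus.ensembleDissipation ν μ := by
  -- adapted from `Theorems/TaylorCertificatesFloorCertificateEnsembleCeilingStubWeakDualityBudget`
  set G : H3 → ℝ≥0∞ := fun u => Torus.eGradNormSq ((u : L2) : Vec3)
  have hGm : Measurable G := Torus.measurable_eGradNormSq_coe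
  have hGfin : ∫⁻ u, G u ∂μ < ∞ := hZ
  have hGlt : ∀ᵐ u ∂μ, G u < ∞ := ae_lt_top hGm hGfin.ne
  have hA : Integrable (fun u => (G u).toReal) μ :=
    integrable_toReal_of_lintegral_ne_top hGm.aemeasurable hGfin.ne
  -- the budget FLOOR holds `μ`-a.e.
  have hae : ∀ᵐ u ∂μ, g u ≤ ν * (G u).toReal + Torus.nsGeneratorPairing ν f u (Φ₁.grad u) +
      2 * θ₁ * (Torus.pairing (u : L2) f - ν * (G u).toReal) := by
    filter_upwards [hGlt, hball] with u hu hb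
    exact hfloor u hu.ne hb
  -- integrate
  have h1 : Integrable (fun u : H3 => ν * (G u).toReal) μ := hA.const_mul ν
  have h2 : Integrable
      (fun u : H3 => ν * (G u).toReal + Torus.nsGeneratorPairing ν f u (Φ₁.grad u)) μ :=
    h1.add hC
  have h3 : Integrable (fun u : H3 => Torus.pairing (u : L2) f - ν * (G u).toReal) μ := hB.sub h1
  have h4 : Integrable
      (fun u : H3 => 2 * θ₁ * (Torus.pairing (u : L2) f - ν * (G u).toReal)) μ :=
    h3.const_mul _
  have hint : Integrable (fun u : H3 => ν * (G u).toReal + Torus.nsGeneratorPairing ν f u (Φ₁.grad u) +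
      2 * θ₁ * (Torus.pairing (u : L2) f - ν * (G u).toReal)) μ := h2.add h4
  have hmono := integral_mono_ae hg hint hae
  have hsplit : ∫ u : H3, (ν * (G u).toReal + Torus.nsGeneratorPairing ν f u (Φ₁.grad u) +
      2 * θ₁ * (Torus.pairing (u : L2) f - ν * (G u).toReal)) ∂μ =
      ν * (∫⁻ u, G u ∂μ).toReal + 0 +
        2 * θ₁ * (∫ u : H3, Torus.pairing (u : L2) f ∂μ - ν * (∫⁻ u, G u ∂μ).toReal) := by
    rw [integral_add h2 h4, integral_add h1 hC, integral_const_mul, integral_const_mul,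
      integral_sub hB h1, integral_const_mul, hC0, integral_toReal hGm.aemeasurable hGlt]
  rw [hsplit] at hmono
  -- the global energy inequality `ν ∫‖∇u‖² ≤ ∫ (u,f)`
  have hE' : ν * (∫⁻ u, G u ∂μ).toReal ≤ ∫ u, Torus.pairing (u : L2) f ∂μ := hE
  have hθ : 2 * θ₁ * (∫ u, Torus.pairing (u : L2) f ∂μ - ν * (∫⁻ u, G u ∂μ).toReal) ≤ 0 :=
    mul_nonpos_of_nonpos_of_nonneg (by linarith) (by linarith)
  change ∫ u, g u ∂μ ≤ ν * (∫⁻ u, G u ∂μ).toReal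
  linarith

/-- **Weak duality for the dissipation floor at one viscosity (relaxed class).** If the constant
budget `ε` satisfies `ε ≤ ν‖∇u‖² + ⟨F(u),Φ₁'(u)⟩ + 2θ₁((u,f) − ν‖∇u‖²)` at every finite-enstrophy
state of the Leray ball, `θ₁ ≤ 0`, and `μ` is a probability measure on `H` carried by the ball, of
finite mean enstrophy, annihilating the Liouville functional of `Φ₁`, with integrable work `(u,f)`
and the global energy inequality `ε(μ) ≤ ∫(u,f)dμ`, then `ε ≤ ε(μ)`. Constant-budget case of the
state-dependent weak duality plus `∫ ε dμ = ε` (`μ` a probability measure). -/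
theorem stub_relaxedLoudOfFloor :
    ∀ (ν : ℝ) (f : Vec3) (Φ₁ : Torus.CylindricalTest (Fin 3)) (θ₁ ε : ℝ) (μ : Measure H3),
      θ₁ ≤ 0 →
      (∀ u : H3, Torus.eGradNormSq ((u : L2) : Vec3) ≠ ⊤ → ‖u‖ ^ 2 ≤ 16 * (∫ x, ‖f x‖ ^ 2) / ν ^ 2 →
        ε ≤ ν * (Torus.eGradNormSq ((u : L2) : Vec3)).toReal + Torus.nsGeneratorPairing ν f u (Φ₁.grad u) +
          2 * θ₁ * (Torus.pairing (u : L2) f - ν * (Torus.eGradNormSq ((u : L2) : Vec3)).toReal)) →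
      IsProbabilityMeasure μ →
      (∀ᵐ u ∂μ, ‖u‖ ^ 2 ≤ 16 * (∫ x, ‖f x‖ ^ 2) / ν ^ 2) →
      Torus.ensembleEnstrophy μ < ⊤ →
      Integrable (fun u : H3 => Torus.nsGeneratorPairing ν f u (Φ₁.grad u)) μ →
      ∫ u, Torus.nsGeneratorPairing ν f u (Φ₁.grad u) ∂μ = 0 →
      Integrable (fun u : H3 => Torus.pairing (u : L2) f) μ →
      Torus.ensembleDissipation ν μ ≤ ∫ u, Torus.pairing (u : L2) f ∂μ →
      ε ≤ Torus.ensembleDissipation ν μ := by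
  intro ν f Φ₁ θ₁ ε μ hθ₁ hfloor hprob hball hZ hgen hgen0 hB hE
  haveI := hprob
  have h := weakDualityBudget_local ν f Φ₁ θ₁ (fun _ => ε) μ hθ₁ hfloor hball hZ hgen hgen0 hB hE
    (integrable_const ε)
  simpa using h

end Summit.AnomalousDissipation.AnomalousDissipation.Theorems.TaylorCertificatesFloorCertificateEnsembleCeiling

end
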